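import Summits.Ventures.HodgeRepro2.T5OrbitHomeomorph
import Summits.Ventures.HodgeRepro2.T5ComponentHilbertSum
import Summits.Ventures.HodgeRepro2.T5InvariantMeasureUnique

/-!
# T5OrbitMeasure — the invariant measure of `[G]/K_f` restricted to an orbit is the quotient Haar
measure of `G_∞ ⧸ Γ_q`, up to a scalar

Cell pub-hodge-repro2, seat p5, Tier 5 (route/T5-N4-p5.md, N4.3 v13 (A3) STEP 1: «The Haar measure
of G(𝔸) induces G_∞-invariant measures on the orbits, and L^{K_f} = ⊕_i L²(Γ_i\G_∞) as unitary
G_∞-modules»).  Row 45 splits `L²([G]/K_f, ν)` along the orbits for an `A = G_∞`-invariant finite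
measure `ν` on `[G]/K_f = FullQuotient H K` (row 45's quotient σ-algebra); row 73 identifies the
`q`-th orbit with `A ⧸ Γ_q` equivariantly.  This file transports `ν` to the orbit and identifies it:

* `measurableSet_of_isOpen` / `instOpensMeasurableSpace`: open sets of `[G]/K_f` are measurable
  for row 45's σ-algebra (the quotient map is continuous);
* `embed H K hK q : A ⧸ Γ_q → [G]/K_f` (row 73's homeomorphism onto the open orbit), an open
  embedding (`isOpenEmbedding_embed`) whose images of Borel sets are measurable
  (`measurableSet_image_embed`) and which is `A`-equivariant (`embed_smul`);
* `orbitMeasure H K hK q ν := Measure.comap (embed …) ν` — «the measure induced on the orbit»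
  (`orbitMeasure_apply : orbitMeasure … ν S = ν (embed '' S)`), FINITE for `ν` finite and
  `A`-INVARIANT for `ν` invariant (`isFiniteMeasure_orbitMeasure`, `smulInvariantMeasure_orbitMeasure`);
* **`orbitMeasure_eq_smul`**: for `H` discrete in `A × B`, `K` compact open, `[G]` compact, `A`
  locally compact second countable Hausdorff with a left Haar measure `μ` and a fundamental domain
  `𝓕` of `Γ_q.op`: `orbitMeasure … ν = c • μ_𝓕` for some `c : ℝ≥0` (row 69's uniqueness) — the
  measure STEP 1 induces on the orbit IS the quotient Haar measure of rows 59–70, up to a scalar,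
  so rows 70 / 72 apply to `L²(orbit, ν|orbit)` whenever `ν` charges the orbit.

Imports rows 45 / 69 / 73 and Mathlib.  Axioms: propext, Classical.choice, Quot.sound.
README §8(d): uses an L-value-free non-vanishing device: NO.
-/

namespace Summit.Ventures.HodgeRepro2.T5OrbitMeasure

open MeasureTheory Set Topology
open scoped NNReal Pointwise
open Summit.Ventures.HodgeRepro2.T5DoubleCosetDecomposition
open Summit.Ventures.HodgeRepro2.T5DoubleCosetTopology
open Summit.Ventures.HodgeRepro2.T5ComponentHilbertSum (measurableSet_fullQuotient_iff)
open Summit.Ventures.HodgeRepro2.T5OrbitHomeomorph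

variable {A B : Type*} [Group A] [Group B] (H : Subgroup (A × B)) (K : Subgroup B)
  [TopologicalSpace A] [TopologicalSpace B]

/-! ### The orbit embedding -/

variable [IsTopologicalGroup A] [IsTopologicalGroup B]

/-- The `q`-th orbit embedding `A ⧸ Γ_q → [G]/K_f`, `[x] ↦ [(x⁻¹, g_q)]` (row 73). -/
noncomputable def embed (hK : IsOpen (K : Set B)) (q : FiniteQuotient H K) :
    A ⧸ gammaGroup H K (rep q) → FullQuotient H K :=
  fun y => (orbitHomeomorph H K hK q y : FullQuotient H K)

/-- `embed = Subtype.val ∘ orbitHomeomorph`. -/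
theorem embed_eq (hK : IsOpen (K : Set B)) (q : FiniteQuotient H K) :
    embed H K hK q = Subtype.val ∘ orbitHomeomorph H K hK q :=
  rfl

/-- `embed` is injective. -/
theorem embed_injective (hK : IsOpen (K : Set B)) (q : FiniteQuotient H K) :
    Function.Injective (embed H K hK q) := fun _ _ h =>
  (orbitHomeomorph H K hK q).injective (Subtype.ext h)

/-- `embed` is an open embedding (a homeomorphism onto the open orbit). -/
theorem isOpenEmbedding_embed (hK : IsOpen (K : Set B)) (q : FiniteQuotient H K) :
    IsOpenEmbedding (embed H K hK q) :=
  (isOpen_range_toFull H K hK q).isOpenEmbedding_subtypeVal.comp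
    (orbitHomeomorph H K hK q).isOpenEmbedding

/-- `embed` is `A`-equivariant. -/
theorem embed_smul (hK : IsOpen (K : Set B)) (q : FiniteQuotient H K) (a : A)
    (y : A ⧸ gammaGroup H K (rep q)) : embed H K hK q (a • y) = a • embed H K hK q y :=
  coe_orbitHomeomorph_smul H K hK q a y

/-! ### Row 45's σ-algebra on `[G]/K_f` contains the Borel sets of the quotient topology -/

variable [MeasurableSpace A] [MeasurableSpace B] [OpensMeasurableSpace (A × B)]

omit [IsTopologicalGroup A] [IsTopologicalGroup B] in
/-- Open sets of `[G]/K_f` are measurable (their preimages in `A × B` are open). -/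
theorem measurableSet_of_isOpen {U : Set (FullQuotient H K)} (hU : IsOpen U) : MeasurableSet U := by
  rw [measurableSet_fullQuotient_iff]
  exact (hU.preimage (continuous_mk H (rightLevel A K))).measurableSet

omit [IsTopologicalGroup A] [IsTopologicalGroup B] in
/-- `[G]/K_f` with row 45's σ-algebra is an `OpensMeasurableSpace` for the quotient topology. -/
instance instOpensMeasurableSpace : OpensMeasurableSpace (FullQuotient H K) :=
  ⟨MeasurableSpace.generateFrom_le fun _ hU => measurableSet_of_isOpen H K hU⟩

/-- Images of Borel sets of `A ⧸ Γ_q` under `embed` are measurable in `[G]/K_f`: `embed '' S` is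
the image under `Subtype.val` of the preimage of `S` under the continuous inverse homeomorphism
on the measurable orbit (`MeasurableSet.subtype_image`). -/
theorem measurableSet_image_embed (hK : IsOpen (K : Set B)) (q : FiniteQuotient H K)
    [MeasurableSpace (A ⧸ gammaGroup H K (rep q))] [BorelSpace (A ⧸ gammaGroup H K (rep q))]
    {S : Set (A ⧸ gammaGroup H K (rep q))} (hS : MeasurableSet S) :
    MeasurableSet (embed H K hK q '' S) := by
  have himg : orbitHomeomorph H K hK q '' S = (orbitHomeomorph H K hK q).symm ⁻¹' S := by
    ext t
    constructor
    · rintro ⟨y, hy, rfl⟩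
      simpa using hy
    · intro ht
      exact ⟨(orbitHomeomorph H K hK q).symm t, ht, (orbitHomeomorph H K hK q).apply_symm_apply t⟩
  rw [embed_eq, Set.image_comp, himg]
  exact (T5ComponentHilbertSum.measurableSet_range_toFull H K hK q).subtype_image
    ((orbitHomeomorph H K hK q).symm.continuous.measurable hS)

/-! ### The measure induced on the orbit -/

/-- **The measure induced on the `q`-th orbit**, as a measure on `A ⧸ Γ_q`:
`orbitMeasure ν S = ν (embed '' S)`. -/
noncomputable def orbitMeasure (hK : IsOpen (K : Set B)) (q : FiniteQuotient H K)
    [MeasurableSpace (A ⧸ gammaGroup H K (rep q))] (ν : Measure (FullQuotient H K)) :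
    Measure (A ⧸ gammaGroup H K (rep q)) :=
  Measure.comap (embed H K hK q) ν

variable (hK : IsOpen (K : Set B)) (q : FiniteQuotient H K)
  [MeasurableSpace (A ⧸ gammaGroup H K (rep q))] [BorelSpace (A ⧸ gammaGroup H K (rep q))]
  (ν : Measure (FullQuotient H K))

/-- `orbitMeasure` on measurable sets. -/
theorem orbitMeasure_apply {S : Set (A ⧸ gammaGroup H K (rep q))} (hS : MeasurableSet S) :
    orbitMeasure H K hK q ν S = ν (embed H K hK q '' S) :=
  Measure.comap_apply _ (embed_injective H K hK q)
    (fun _ hs => measurableSet_image_embed H K hK q hs) ν hS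

/-- The induced measure is finite for `ν` finite. -/
theorem isFiniteMeasure_orbitMeasure [IsFiniteMeasure ν] :
    IsFiniteMeasure (orbitMeasure H K hK q ν) :=
  ⟨by rw [orbitMeasure_apply H K hK q ν MeasurableSet.univ]; exact measure_lt_top _ _⟩

omit [MeasurableSpace A] [MeasurableSpace B] [OpensMeasurableSpace (A × B)]
  [MeasurableSpace (A ⧸ gammaGroup H K (rep q))] [BorelSpace (A ⧸ gammaGroup H K (rep q))] in
/-- The image of a translate: `embed '' ((a • ·) ⁻¹' S) = (a • ·) ⁻¹' (embed '' S)`. -/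
theorem image_embed_preimage_smul (a : A) (S : Set (A ⧸ gammaGroup H K (rep q))) :
    embed H K hK q '' ((a • ·) ⁻¹' S) = (a • ·) ⁻¹' (embed H K hK q '' S) := by
  ext t
  simp only [Set.mem_image, Set.mem_preimage]
  constructor
  · rintro ⟨y, hy, rfl⟩
    exact ⟨a • y, hy, embed_smul H K hK q a y⟩
  · rintro ⟨y, hy, hyt⟩
    -- `t` lies in the orbit: `a • t = embed y` does, and the orbit is `A`-stable
    have hmem : a • t ∈ Set.range (toFull q) := by
      rw [← hyt]; exact (orbitHomeomorph H K hK q y).2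
    have ht : t ∈ Set.range (toFull q) := by
      have h := T5ComponentHilbertSum.preimage_smul_range_toFull H K a q
      rw [← h]; exact hmem
    have hy' : embed H K hK q ((orbitHomeomorph H K hK q).symm ⟨t, ht⟩) = t := by
      simp [embed]
    refine ⟨(orbitHomeomorph H K hK q).symm ⟨t, ht⟩, ?_, hy'⟩
    have : embed H K hK q (a • (orbitHomeomorph H K hK q).symm ⟨t, ht⟩) = embed H K hK q y := by
      rw [embed_smul, hy', hyt]
    rw [embed_injective H K hK q this]
    exact hy

/-- The induced measure is `A`-invariant for `ν` invariant (`embed` is equivariant). -/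
theorem smulInvariantMeasure_orbitMeasure [BorelSpace A]
    [SMulInvariantMeasure A (FullQuotient H K) ν] :
    SMulInvariantMeasure A (A ⧸ gammaGroup H K (rep q)) (orbitMeasure H K hK q ν) := by
  refine ⟨fun a S hS => ?_⟩
  rw [orbitMeasure_apply H K hK q ν (measurableSet_preimage (measurable_const_smul a) hS),
    orbitMeasure_apply H K hK q ν hS, image_embed_preimage_smul,
    SMulInvariantMeasure.measure_preimage_smul a (measurableSet_image_embed H K hK q hS)]

/-- **The induced measure on the orbit is the quotient Haar measure, up to a scalar**: for `H`
discrete in `A × B`, `K` compact open, `[G]/K_f` compact, `A` locally compact second countable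
Hausdorff with a left Haar measure `μ`, a fundamental domain `𝓕` of `Γ_q.op`, and an `A`-invariant
finite measure `ν` on `[G]/K_f`: `orbitMeasure … ν = c • μ_𝓕`. -/
theorem orbitMeasure_eq_smul [BorelSpace A] [T2Space A] [LocallyCompactSpace A]
    [SecondCountableTopology A] [T2Space B] [DiscreteTopology H]
    (hKc : IsCompact (K : Set B)) [CompactSpace (FullQuotient H K)] (μ : Measure A)
    [μ.IsHaarMeasure] {𝓕 : Set A} (h𝓕 : IsFundamentalDomain (gammaGroup H K (rep q)).op 𝓕 μ)
    [IsFiniteMeasure ν] [SMulInvariantMeasure A (FullQuotient H K) ν] :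
    ∃ c : ℝ≥0, orbitMeasure H K hK q ν =
      c • Measure.map (QuotientGroup.mk : A → A ⧸ gammaGroup H K (rep q)) (μ.restrict 𝓕) :=
  haveI := T5CocompactInversion.discreteTopology_gammaGroup H K hKc (rep q)
  haveI := T5CocompactInversion.compactSpace_quotient_gammaGroup H K hK q
  haveI := isFiniteMeasure_orbitMeasure H K hK q ν
  haveI := smulInvariantMeasure_orbitMeasure H K hK q ν
  T5InvariantMeasureUnique.eq_smul_quotientMeasure (orbitMeasure H K hK q ν) μ h𝓕

end Summit.Ventures.HodgeRepro2.T5OrbitMeasure
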